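import Literature.NumberTheory.EllipticCurves.Kato2004.EulerSystemValues
import HarnessLib

/-!
# The Euler-factor twist operator `Σ_g P_g • (1 ⊗ σ_g)` on `ℚ_p ⊗_ℚ ℚ(ζ_n)` for `P = 3 − a·δ_w + δ_{w²}`
# is INJECTIVE, and acts on `ℚ_p ⊗ 1` as multiplication by `P(1) = 4 − a` (pure algebra)

Cell `bsd-addord`, seat `bsd-addord-w2-c4` (gen 10; owner of crux 19599 `ShallowEqDeepOffKatoStratum` of route W2
`KimAtThreeKolyvagin`).  `--supports` 19599 (helper: the algebra under the good ANOMALOUS rows' Euler-factor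
lattice, gen 9's (C1_τ)).  HONEST FRAMING: pure algebra, general prime `p` and level `n`; no elliptic curve, no
named fact, no `sorry`; nothing booked; BSD is not proved by any of this.

## What, and why
Gen 9 read Kato's dual-exponential lattice at a good `3` through the operator
`Tw_P : v ↦ Σ_{g ∈ (ℤ/n)ˣ} P_g • (1 ⊗ σ_g) v` on `ℚ_p ⊗_ℚ ℚ(ζ_n)`, `P = 3 − a·δ_w + δ_{w²} ∈ ℤ_p[(ℤ/n)ˣ]`
(`w = [3]⁻¹`, `a = a₃`), i.e. `Tw_P = 3 − a·S + S²` with `S = 1 ⊗ σ_w`.  To extract the scalar of the twisted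
rider from a φ-level (defined-Kato) package one needs: (i) `Tw_P (x ⊗ 1) = (4 − a)·x ⊗ 1` and (ii) `Tw_P` is
INJECTIVE.  (ii) holds because `S` has finite order `d` and `X² − aX + 3` is coprime to `X^d − 1` in `ℚ[X]`
(it is irreducible for `a² < 12` — no real root — and does not divide `X^d − 1`: by Gauss over `ℤ` its constant
term `3` would divide `−1`).
* §1 `tensorSigma_*` — `(1 ⊗ σ_g)` is `ℚ_p`-linear, multiplicative in `g`, trivial at `g = 1`, fixes `x ⊗ 1`.
* §2 `twist_eq_poly` — `Tw_P v = 3•v − a•S v + S (S v)`; `twist_tmul_one` — (i).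
* §3 `isCoprime_quadratic_X_pow_sub_one` — `IsCoprime (X² − aX + 3) (X^d − 1)` in `ℚ[X]` for `a² < 12`, `d ≥ 1`.
* §4 **`twist_injective`** — (ii) for `a² < 12`.
References: [Kim2022StructureSelmer] §3.2.3, Lemma 3.4, Cor. 3.5 (the Euler-factor lattice); [Kato2004Asterisque]
(5.7.1) (`σ_b`), Thm. 9.7; memo HOME/w2c4/W2C4-ANOMALOUS-PORT-g9.md §2, W2C4-MULT-TWOEXP-g10.md §7.
-/

set_option autoImplicit false
-- the Theorems namespace of a single-conjunct summit repeats the summit name by design (D-0017)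
set_option linter.dupNamespace false

noncomputable section

open scoped TensorProduct Polynomial
open Polynomial
open Literature.NumberTheory.EllipticCurves.Kato2004.EulerSystemValues

namespace Summit.BirchSwinnertonDyer.BirchSwinnertonDyer.Theorems.KimAtThreeShallowEqDeepTwistInjective

variable (p : ℕ) [Fact p.Prime] (n : ℕ) [NeZero n]

/-- Local notation: `(1 ⊗ σ_g)` on `ℚ_p ⊗_ℚ ℚ(ζ_n)` as a `ℚ`-algebra map. -/
local notation3 "𝐒⟦" g "⟧" => Algebra.TensorProduct.map (AlgHom.id ℚ ℚ_[p])
  (sigma n g : CyclotomicField n ℚ →ₐ[ℚ] CyclotomicField n ℚ)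

/-- Local notation: the twist operator `Tw_P v = Σ_g P_g • (1 ⊗ σ_g) v`. -/
local notation3 "𝐓𝐰⟦" P ", " v "⟧" => ∑ g : (ZMod n)ˣ, ((MonoidAlgebra.coeff P g : ℤ_[p]) : ℚ_[p]) •
  Algebra.TensorProduct.map (AlgHom.id ℚ ℚ_[p]) (sigma n g : CyclotomicField n ℚ →ₐ[ℚ] CyclotomicField n ℚ) v

/-! ### §1 `(1 ⊗ σ_g)`: scalars, multiplicativity, the fixed line `ℚ_p ⊗ 1` -/

set_option backward.isDefEq.respectTransparency false in
/-- `(1 ⊗ σ_g)` commutes with `ℚ_p`-scalars. [folklore] -/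
theorem tensorSigma_smul (g : (ZMod n)ˣ) (r : ℚ_[p]) (v : ℚ_[p] ⊗[ℚ] CyclotomicField n ℚ) :
    𝐒⟦g⟧ (r • v) = r • 𝐒⟦g⟧ v := by
  induction v using TensorProduct.induction_on with
  | zero => rw [smul_zero, map_zero, smul_zero]
  | tmul a w =>
    rw [TensorProduct.smul_tmul', Algebra.TensorProduct.map_tmul, Algebra.TensorProduct.map_tmul,
      TensorProduct.smul_tmul']
    rfl
  | add u w hu hw => rw [smul_add, map_add, map_add, hu, hw, smul_add]

set_option backward.isDefEq.respectTransparency false in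
/-- `(1 ⊗ σ_{gh}) = (1 ⊗ σ_g) ∘ (1 ⊗ σ_h)` (`σ` is a group action). [folklore] -/
theorem tensorSigma_mul (g h : (ZMod n)ˣ) (v : ℚ_[p] ⊗[ℚ] CyclotomicField n ℚ) :
    𝐒⟦g * h⟧ v = 𝐒⟦g⟧ (𝐒⟦h⟧ v) := by
  induction v using TensorProduct.induction_on with
  | zero => rw [map_zero, map_zero, map_zero]
  | tmul a w =>
    rw [Algebra.TensorProduct.map_tmul, Algebra.TensorProduct.map_tmul, Algebra.TensorProduct.map_tmul]
    congr 1
    change sigma n (g * h) w = sigma n g (sigma n h w)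
    rw [sigma, map_mul, AlgEquiv.mul_apply]
    rfl
  | add u w hu hw => rw [map_add, map_add, map_add, hu, hw]

set_option backward.isDefEq.respectTransparency false in
/-- `(1 ⊗ σ_1) = id`. [folklore] -/
theorem tensorSigma_one (v : ℚ_[p] ⊗[ℚ] CyclotomicField n ℚ) : 𝐒⟦1⟧ v = v := by
  induction v using TensorProduct.induction_on with
  | zero => rw [map_zero]
  | tmul a w =>
    rw [Algebra.TensorProduct.map_tmul]
    congr 1
    change sigma n 1 w = w
    rw [sigma, map_one]
    rfl
  | add u w hu hw => rw [map_add, hu, hw]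

/-- `(1 ⊗ σ_g)` fixes `x ⊗ 1`. [folklore] -/
theorem tensorSigma_tmul_one (g : (ZMod n)ˣ) (x : ℚ_[p]) :
    𝐒⟦g⟧ (x ⊗ₜ[ℚ] (1 : CyclotomicField n ℚ)) = x ⊗ₜ[ℚ] (1 : CyclotomicField n ℚ) := by
  rw [Algebra.TensorProduct.map_tmul, map_one]
  rfl

/-! ### §2 The twist operator: additivity in `P`, single terms, the polynomial form, the fixed line -/

/-- `Tw_{P+Q} = Tw_P + Tw_Q`. [folklore] -/
theorem twist_add (P Q : MonoidAlgebra ℤ_[p] (ZMod n)ˣ) (v : ℚ_[p] ⊗[ℚ] CyclotomicField n ℚ) :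
    𝐓𝐰⟦P + Q, v⟧ = 𝐓𝐰⟦P, v⟧ + 𝐓𝐰⟦Q, v⟧ := by
  rw [← Finset.sum_add_distrib]
  refine Finset.sum_congr rfl fun g _ => ?_
  rw [MonoidAlgebra.coeff_add, Finsupp.add_apply, PadicInt.coe_add, add_smul]

/-- `Tw_{−P} = −Tw_P`. [folklore] -/
theorem twist_neg (P : MonoidAlgebra ℤ_[p] (ZMod n)ˣ) (v : ℚ_[p] ⊗[ℚ] CyclotomicField n ℚ) :
    𝐓𝐰⟦-P, v⟧ = -𝐓𝐰⟦P, v⟧ := by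
  rw [← Finset.sum_neg_distrib]
  refine Finset.sum_congr rfl fun g _ => ?_
  rw [MonoidAlgebra.coeff_neg, Finsupp.neg_apply, PadicInt.coe_neg, neg_smul]

/-- `Tw_{P−Q} = Tw_P − Tw_Q`. [folklore] -/
theorem twist_sub (P Q : MonoidAlgebra ℤ_[p] (ZMod n)ˣ) (v : ℚ_[p] ⊗[ℚ] CyclotomicField n ℚ) :
    𝐓𝐰⟦P - Q, v⟧ = 𝐓𝐰⟦P, v⟧ - 𝐓𝐰⟦Q, v⟧ := by
  rw [sub_eq_add_neg, twist_add, twist_neg, ← sub_eq_add_neg]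

/-- `Tw_{c·δ_g} v = c • (1 ⊗ σ_g) v`. [folklore] -/
theorem twist_single (g : (ZMod n)ˣ) (c : ℤ_[p]) (v : ℚ_[p] ⊗[ℚ] CyclotomicField n ℚ) :
    𝐓𝐰⟦MonoidAlgebra.single g c, v⟧ = (c : ℚ_[p]) • 𝐒⟦g⟧ v := by
  rw [Finset.sum_eq_single g]
  · rw [MonoidAlgebra.single, MonoidAlgebra.coeff_ofCoeff, Finsupp.single_eq_same]
  · intro h _ hne
    have h0 : (MonoidAlgebra.single g c).coeff h = 0 := by
      rw [MonoidAlgebra.single, MonoidAlgebra.coeff_ofCoeff, Finsupp.single_apply, if_neg (Ne.symm hne)]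
    rw [h0, PadicInt.coe_zero, zero_smul]
  · intro hg
    exact absurd (Finset.mem_univ g) hg

/-- `Tw_{m} v = m • v` for a natural number `m` (`(m : ℤ_p[G]) = m·δ_1`). [folklore] -/
theorem twist_natCast (m : ℕ) (v : ℚ_[p] ⊗[ℚ] CyclotomicField n ℚ) :
    𝐓𝐰⟦(m : MonoidAlgebra ℤ_[p] (ZMod n)ˣ), v⟧ = (m : ℚ_[p]) • v := by
  rw [MonoidAlgebra.natCast_def, twist_single, tensorSigma_one, PadicInt.coe_natCast]

/-- **The polynomial form**: for `P = 3 − a·δ_w + δ_{w²}`,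
`Tw_P v = 3 • v − a • (1 ⊗ σ_w) v + (1 ⊗ σ_w)((1 ⊗ σ_w) v)`. [folklore] -/
theorem twist_eq_poly (w : (ZMod n)ˣ) (a : ℤ) (v : ℚ_[p] ⊗[ℚ] CyclotomicField n ℚ) :
    𝐓𝐰⟦((3 : ℕ) : MonoidAlgebra ℤ_[p] (ZMod n)ˣ) - MonoidAlgebra.single w (a : ℤ_[p]) +
        MonoidAlgebra.single (w ^ 2) (1 : ℤ_[p]), v⟧ =
      (3 : ℚ_[p]) • v - (a : ℚ_[p]) • 𝐒⟦w⟧ v + 𝐒⟦w⟧ (𝐒⟦w⟧ v) := by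
  rw [twist_add, twist_sub, twist_natCast, twist_single, twist_single, PadicInt.coe_one, one_smul,
    PadicInt.coe_intCast, pow_two, tensorSigma_mul, Nat.cast_ofNat]

/-- **The fixed line**: `Tw_P (x ⊗ 1) = (Σ_g P_g)·x ⊗ 1`; for `P = 3 − a·δ_w + δ_{w²}` this is `(4 − a)·x ⊗ 1`.
[folklore] -/
theorem twist_tmul_one (w : (ZMod n)ˣ) (a : ℤ) (x : ℚ_[p]) :
    𝐓𝐰⟦((3 : ℕ) : MonoidAlgebra ℤ_[p] (ZMod n)ˣ) - MonoidAlgebra.single w (a : ℤ_[p]) +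
        MonoidAlgebra.single (w ^ 2) (1 : ℤ_[p]), x ⊗ₜ[ℚ] (1 : CyclotomicField n ℚ)⟧ =
      (((4 : ℤ) - a : ℤ) : ℚ_[p]) • (x ⊗ₜ[ℚ] (1 : CyclotomicField n ℚ)) := by
  rw [twist_eq_poly, tensorSigma_tmul_one, tensorSigma_tmul_one, Int.cast_sub]
  push_cast
  module

/-! ### §3 `X² − aX + 3` is coprime to `X^d − 1` in `ℚ[X]` when `a² < 12` -/

/-- **`IsCoprime (X² − aX + 3) (X^d − 1)` in `ℚ[X]`** for an integer `a` with `a² < 12` and `d ≥ 1`: the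
quadratic has no rational (indeed no real) root, so it is irreducible; and it does not divide `X^d − 1` — by
Gauss's lemma for the monic integer quadratic the quotient would be integral, and evaluating at `0` would give
`3 ∣ −1`. [folklore] -/
theorem isCoprime_quadratic_X_pow_sub_one (a : ℤ) (ha : a ^ 2 < 12) {d : ℕ} (hd : 1 ≤ d) :
    IsCoprime (X ^ 2 - C (a : ℚ) * X + C 3 : ℚ[X]) (X ^ d - 1) := by
  set fZ : ℤ[X] := X ^ 2 - C a * X + C 3 with hfZ
  have hmonic : fZ.Monic := by rw [hfZ]; monicity!
  have hmap : (fZ.map (Int.castRingHom ℚ)) = (X ^ 2 - C (a : ℚ) * X + C 3 : ℚ[X]) := by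
    rw [hfZ]
    simp
    exact (map_ofNat C 3).symm
  have hmonicQ : (X ^ 2 - C (a : ℚ) * X + C 3 : ℚ[X]).Monic := by rw [← hmap]; exact hmonic.map _
  have hdeg : (X ^ 2 - C (a : ℚ) * X + C 3 : ℚ[X]).natDegree = 2 := by compute_degree!
  -- irreducible: degree 2 and no rational root (no real root: `a² < 12`)
  have hirr : Irreducible (X ^ 2 - C (a : ℚ) * X + C 3 : ℚ[X]) := by
    refine (hmonicQ.irreducible_iff_roots_eq_zero_of_degree_le_three (by rw [hdeg]) (by rw [hdeg]; norm_num)).2 ?_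
    refine Multiset.eq_zero_of_forall_notMem fun x hx => ?_
    rw [mem_roots hmonicQ.ne_zero, IsRoot.def] at hx
    simp only [eval_add, eval_sub, eval_pow, eval_X, eval_mul, eval_C] at hx
    have ha' : ((a : ℚ)) ^ 2 < 12 := by exact_mod_cast ha
    nlinarith [sq_nonneg (2 * x - (a : ℚ))]
  -- does not divide `X^d − 1`: Gauss + evaluation at `0`
  refine (hirr.coprime_iff_not_dvd).2 fun hdvd => ?_
  have hdvdZ : fZ ∣ (X ^ d - 1 : ℤ[X]) := by
    rw [← Polynomial.map_dvd_map (Int.castRingHom ℚ) Int.cast_injective hmonic, hmap]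
    simpa using hdvd
  have h0 := Polynomial.eval_dvd (x := (0 : ℤ)) hdvdZ
  rw [hfZ] at h0
  simp only [eval_add, eval_sub, eval_pow, eval_X, eval_mul, eval_C, eval_one,
    zero_pow (by omega : d ≠ 0), zero_pow two_ne_zero, mul_zero, sub_zero, zero_add, zero_sub] at h0
  omega

/-! ### §4 Injectivity of the twist operator -/

set_option backward.isDefEq.respectTransparency false in
/-- **The Euler-factor twist operator is injective**: for `P = 3 − a·δ_w + δ_{w²} ∈ ℤ_p[(ℤ/n)ˣ]` with `a² < 12`,
`Σ_g P_g • (1 ⊗ σ_g) v = 0 ⇒ v = 0` on `ℚ_p ⊗_ℚ ℚ(ζ_n)`.  Proof: with `S = 1 ⊗ σ_w` (a `ℚ`-linear map of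
finite order `d = ord w`), `Tw_P = f(S)` for `f = X² − aX + 3`; `f` and `X^d − 1` are coprime (§3), so
`u·f + t·(X^d − 1) = 1` gives `v = u(S)(f(S)v) = 0`. [folklore] -/
theorem twist_injective (w : (ZMod n)ˣ) (a : ℤ) (ha : a ^ 2 < 12) (v : ℚ_[p] ⊗[ℚ] CyclotomicField n ℚ)
    (hv : 𝐓𝐰⟦((3 : ℕ) : MonoidAlgebra ℤ_[p] (ZMod n)ˣ) - MonoidAlgebra.single w (a : ℤ_[p]) +
        MonoidAlgebra.single (w ^ 2) (1 : ℤ_[p]), v⟧ = 0) :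
    v = 0 := by
  rw [twist_eq_poly] at hv
  -- `S` as a `ℚ`-linear endomorphism
  set S : Module.End ℚ (ℚ_[p] ⊗[ℚ] CyclotomicField n ℚ) := (𝐒⟦w⟧).toLinearMap with hS
  have hSv : ∀ u, S u = 𝐒⟦w⟧ u := fun u => rfl
  have hSpow : ∀ (k : ℕ) (u : ℚ_[p] ⊗[ℚ] CyclotomicField n ℚ), (S ^ k) u = 𝐒⟦w ^ k⟧ u := by
    intro k
    induction k with
    | zero => intro u; rw [pow_zero, pow_zero, Module.End.one_apply, tensorSigma_one]
    | succ k ih => intro u; rw [pow_succ, Module.End.mul_apply, hSv, ih, pow_succ, tensorSigma_mul]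
  set d : ℕ := orderOf w with hd
  have hd1 : 1 ≤ d := orderOf_pos w
  have hSd : S ^ d = 1 := by
    refine LinearMap.ext fun u => ?_
    rw [hSpow, hd, pow_orderOf_eq_one, tensorSigma_one, Module.End.one_apply]
  -- `f(S) v = 0`
  set f : ℚ[X] := X ^ 2 - C (a : ℚ) * X + C 3 with hf
  have hfS : (aeval S f) v = 0 := by
    rw [hf, map_add, map_sub, map_mul, aeval_C, aeval_C, map_pow, aeval_X, LinearMap.add_apply,
      LinearMap.sub_apply, Module.End.mul_apply, hSpow, pow_two, tensorSigma_mul,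
      Module.algebraMap_end_apply, Module.algebraMap_end_apply, hSv]
    have h3 : (3 : ℚ) • v = (3 : ℚ_[p]) • v := by
      rw [← algebraMap_smul ℚ_[p] (3 : ℚ) v, map_ofNat]
    have ha' : (a : ℚ) • 𝐒⟦w⟧ v = (a : ℚ_[p]) • 𝐒⟦w⟧ v := by
      rw [← algebraMap_smul ℚ_[p] (a : ℚ) (𝐒⟦w⟧ v), map_intCast]
    rw [h3, ha']
    rw [← hv]
    abel
  -- Bézout
  obtain ⟨u, t, hut⟩ := isCoprime_quadratic_X_pow_sub_one a ha hd1
  have h1 : aeval S (u * f + t * (X ^ d - 1)) = 1 := by rw [hut, map_one]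
  have key : (aeval S (u * f + t * (X ^ d - 1))) v = v := by rw [h1, Module.End.one_apply]
  rw [map_add, map_mul, map_mul, map_sub, map_pow, aeval_X, map_one, hSd, sub_self, mul_zero, add_zero,
    Module.End.mul_apply, hfS, map_zero] at key
  exact key.symm

end Summit.BirchSwinnertonDyer.BirchSwinnertonDyer.Theorems.KimAtThreeShallowEqDeepTwistInjective

end
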